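import Summits.ABC.ABC.Theses.IneffectiveSubspace
import Summits.ABC.ABC.Theses.NegOmegaAtlas
import Summits.ABC.ABC.Theorems.IneffectiveSubspaceUniformSadicTowerFourHeavyCollapse
import Summits.ABC.ABC.Theorems.IneffectiveSubspaceUniformSadicTowerFourStubOmegaCountedTwo
import Literature.NumberTheory.DiophantineGeometry.AbcWave0QualityFormProofs

/-!
# `UniformSadicTowerFour` (stmt-ABC-14937) modulo crux #6: the cross-route KILL PATHS by name (line `flat-steep-split`, lead c3)

Crux #2 of route `IneffectiveSubspace` ("Ridout at level four") gives, outright, abc with a constant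
`C(W, ε)` on every bounded-`ω` cell `{ω(abc) ≤ W}` — BoundedOmegaABC —
(`HeavyPlaces.boundedOmega_of_uniformSadicTowerFour`, p148129), and under the route's other load-bearing
crux #6 `DeepRegimeABC` the two are equivalent
(`HeavyPlaces.uniformSadicTowerFour_iff_boundedOmega_of_deepRegimeABC`, p148129;
`Theorems/IneffectiveSubspaceUniformSadicTowerFourHeavyCollapse.lean`).  This file records that, in its
FINITENESS form ("for every `W` and `δ > 0` only finitely many abc triples have `ω(abc) ≤ W` and quality
`> 1 + δ`"), BoundedOmegaABC is LITERALLY the negation of the target `NegThesis` of the negative-side route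
`NegOmegaAtlas` (stmt-ABC-1224), and draws the consequences by name:

* `finite_violators_of_boundedOmegaAt`, `boundedOmegaAt_of_finite_violators`,
  `boundedOmegaAt_iff_finite_violators`: one cell `{ω(abc) ≤ W}` in its two forms — constant form
  `∀ ε ∃ C, c < C·rad^(1+ε)` and finiteness form `∀ δ, {violators of margin δ} finite`
  (Bombieri–Gubler Rem. 12.4.15, per cell);
* `boundedOmega_iff_not_negThesis` (**the identification**): BoundedOmegaABC `↔ ¬NegThesis`;
* `not_negThesis_of_uniformSadicTowerFour`: a proof of this crux REFUTES route `NegOmegaAtlas`'s target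
  (no #6 needed); contrapositive `not_uniformSadicTowerFour_of_negThesis`; and modulo #6 the crux is
  EXACTLY `¬NegThesis` (`uniformSadicTowerFour_iff_not_negThesis`);
* the KILL PATHS: each cell crux of the atlas — `ThreeSlotFamily` (stmt-ABC-1227), `UnbalancedFamily`
  (stmt-ABC-1225), `BalancedFamily` (stmt-ABC-1226) — implies `NegThesis`, hence refutes this crux
  (`not_uniformSadicTowerFour_of_threeSlotFamily / _of_unbalancedFamily / _of_balancedFamily`);
* the `ω`-LADDER: the cells are monotone in `W` (`boundedOmegaAt_mono`); `W ≤ 2` is a theorem of the tree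
  (`MixedRadical.stub_omegaCounted_two`, p97349, `Theorems/IneffectiveSubspaceUniformSadicTowerFourStubOmegaCountedTwo.lean`;
  here `boundedOmegaAt_of_le_two`); the first open rung `W = 3` is `¬ThreeSlotFamily`
  (`boundedOmegaAt_three_iff_not_threeSlotFamily`), so the crux needs it
  (`not_threeSlotFamily_of_uniformSadicTowerFour`).

So the typed enemy list of crux #2 modulo #6 is the bounded-`ω` atlas of route `NegOmegaAtlas`, not level-4
families.  Port of the kernel-checked strategist workfile `Cruxes/UniformSadicTowerFour/StrategistS1.lean`
§2–§3 (seat s1) with its vocabulary (`BoundedOmegaAt`, `Violators`) inlined.  No new definitions.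
Deliberately NOT here: BoundedOmegaABC itself or any of its rungs `W ≥ 3` (open, abc-type), `DeepRegimeABC`
(crux #6, only ever an explicit hypothesis `h₆`).

References: E. Bombieri, W. Gubler, *Heights in Diophantine Geometry*, CUP 2006, Remark 12.4.15 (the abc-ratio
/ quality and the passage constant form ⟷ finiteness form).
-/

noncomputable section

-- `Summit.<Summit>.<Problem>` is the mandated summit-side namespace (CONVENTIONS §2); for the
-- single-conjunct summit `ABC` the two coincide, so the duplicate `ABC.ABC` is deliberate.
set_option linter.dupNamespace false

namespace Summit.ABC.ABC.Theorems.UniformSadicTowerFour.BoundedOmega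

open Literature.NumberTheory.DiophantineGeometry (IsABCTriple rad quality)
open Summit.ABC.ABC.Theses.IneffectiveSubspace (UniformSadicTowerFour DeepRegimeABC)
open Summit.ABC.ABC.Theses.NegOmegaAtlas (NegThesis ThreeSlotFamily UnbalancedFamily BalancedFamily)
open Summit.ABC.ABC.Theorems.UniformSadicTowerFour.HeavyPlaces
  (boundedOmega_of_uniformSadicTowerFour uniformSadicTowerFour_iff_boundedOmega_of_deepRegimeABC)
open Summit.ABC.ABC.Theorems.UniformSadicTowerFour.MixedRadical (stub_omegaCounted_two)

/-! ## One cell in its two forms: constant form ⟷ finiteness of the violators -/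

/-- **Constant form ⟹ finiteness form on a cell.** If abc holds with a constant `C(ε)` on the cell
`{ω(abc) ≤ W}`, then for every `δ > 0` the level-`W` violators of margin `δ` (abc triples with
`ω(abc) ≤ W` and quality `> 1 + δ` — verbatim the set whose infinitude `NegOmegaAtlas.NegThesis` asserts)
are finite: with `C = C(δ/2)` a violator has `rad^(δ/2) < C`, hence bounded radical and bounded `c`.
(Bombieri–Gubler Rem. 12.4.15, per cell.) [cite: BombieriGubler2006, Rem. 12.4.15] -/
theorem finite_violators_of_boundedOmegaAt {W : ℕ}
    (H : ∀ ε : ℝ, 0 < ε → ∃ C : ℝ, 0 < C ∧ ∀ a b c : ℕ, IsABCTriple a b c →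
      (a * b * c).primeFactors.card ≤ W → (c : ℝ) < C * ((rad a b c : ℕ) : ℝ) ^ (1 + ε)) :
    ∀ δ : ℝ, 0 < δ → {t : ℕ × ℕ × ℕ | IsABCTriple t.1 t.2.1 t.2.2 ∧
      (t.1 * t.2.1 * t.2.2).primeFactors.card ≤ W ∧ 1 + δ < quality t.1 t.2.1 t.2.2}.Finite := by
  intro δ hδ
  obtain ⟨C, hC, hCabc⟩ := H (δ / 2) (half_pos hδ)
  set R : ℕ := ⌈C ^ (2 / δ)⌉₊
  set N : ℕ := ⌈C * (R : ℝ) ^ (1 + δ / 2)⌉₊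
  refine ((Set.finite_Iic N).prod ((Set.finite_Iic N).prod (Set.finite_Iic N))).subset ?_
  rintro ⟨a, b, c⟩ hmem
  obtain ⟨ht, hω, hq⟩ : IsABCTriple a b c ∧ (a * b * c).primeFactors.card ≤ W ∧
      1 + δ < quality a b c := hmem
  have hlt : (c : ℝ) < C * (rad a b c : ℝ) ^ (1 + δ / 2) := hCabc a b c ht hω
  rw [ht.one_add_lt_quality_iff] at hq
  have hr1 : (1 : ℝ) < (rad a b c : ℝ) := by exact_mod_cast ht.two_le_rad
  have hr0 : (0 : ℝ) < (rad a b c : ℝ) := zero_lt_one.trans hr1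
  have hpos : (0 : ℝ) < (rad a b c : ℝ) ^ (1 + δ / 2) := Real.rpow_pos_of_pos hr0 _
  -- `rad^(δ/2) < C`
  have h1 : (rad a b c : ℝ) ^ (δ / 2) < C := by
    have hsplit : (rad a b c : ℝ) ^ (1 + δ) =
        (rad a b c : ℝ) ^ (1 + δ / 2) * (rad a b c : ℝ) ^ (δ / 2) := by
      rw [← Real.rpow_add hr0]
      congr 1
      ring
    have h := hq.trans hlt
    rw [hsplit, mul_comm C] at h
    exact lt_of_mul_lt_mul_left h hpos.le
  -- `rad < C^(2/δ)`, hence `rad ≤ R`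
  have h2 : (rad a b c : ℝ) ≤ R := by
    have h := Real.rpow_lt_rpow (Real.rpow_pos_of_pos hr0 _).le h1 (show (0 : ℝ) < 2 / δ by positivity)
    rw [← Real.rpow_mul hr0.le, show δ / 2 * (2 / δ) = 1 by field_simp, Real.rpow_one] at h
    exact h.le.trans (Nat.le_ceil _)
  -- `c < C · R^(1+δ/2)`, hence `c ≤ N`
  have h3 : (c : ℝ) ≤ N := by
    have hRpow : (rad a b c : ℝ) ^ (1 + δ / 2) ≤ (R : ℝ) ^ (1 + δ / 2) :=
      Real.rpow_le_rpow hr0.le h2 (by positivity)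
    have h : (c : ℝ) < C * (R : ℝ) ^ (1 + δ / 2) :=
      hlt.trans_le (mul_le_mul_of_nonneg_left hRpow hC.le)
    exact h.le.trans (Nat.le_ceil _)
  have hcN : c ≤ N := by exact_mod_cast h3
  obtain ⟨ha, hb, habc, -⟩ := ht
  simp only [Set.mem_prod, Set.mem_Iic]
  omega

/-- **Finiteness form ⟹ constant form on a cell.** If for every `δ > 0` the level-`W` violators of
margin `δ` are finite, then abc holds with a constant on `{ω(abc) ≤ W}`: the finitely many violators of
margin `ε` have `c ≤ N`; every other triple of the cell has `c ≤ rad^(1+ε)`; `C = N + 2` serves.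
[cite: BombieriGubler2006, Rem. 12.4.15] -/
theorem boundedOmegaAt_of_finite_violators {W : ℕ}
    (H : ∀ δ : ℝ, 0 < δ → {t : ℕ × ℕ × ℕ | IsABCTriple t.1 t.2.1 t.2.2 ∧
      (t.1 * t.2.1 * t.2.2).primeFactors.card ≤ W ∧ 1 + δ < quality t.1 t.2.1 t.2.2}.Finite) :
    ∀ ε : ℝ, 0 < ε → ∃ C : ℝ, 0 < C ∧ ∀ a b c : ℕ, IsABCTriple a b c →
      (a * b * c).primeFactors.card ≤ W → (c : ℝ) < C * ((rad a b c : ℕ) : ℝ) ^ (1 + ε) := by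
  intro ε hε
  obtain ⟨N, hN⟩ : ∃ N : ℕ, ∀ t ∈ {t : ℕ × ℕ × ℕ | IsABCTriple t.1 t.2.1 t.2.2 ∧
      (t.1 * t.2.1 * t.2.2).primeFactors.card ≤ W ∧ 1 + ε < quality t.1 t.2.1 t.2.2}, t.2.2 ≤ N := by
    obtain ⟨N, hN⟩ := ((H ε hε).image fun t => t.2.2).bddAbove
    exact ⟨N, fun t ht => hN (Set.mem_image_of_mem _ ht)⟩
  refine ⟨(N : ℝ) + 2, by positivity, fun a b c ht hω => ?_⟩
  have hr1 : (1 : ℝ) ≤ (rad a b c : ℝ) := by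
    exact_mod_cast le_trans (by norm_num) ht.two_le_rad
  have hpow1 : (1 : ℝ) ≤ (rad a b c : ℝ) ^ (1 + ε) := Real.one_le_rpow hr1 (by positivity)
  by_cases hq : 1 + ε < quality a b c
  · have hc : c ≤ N := hN (a, b, c) ⟨ht, hω, hq⟩
    have hc' : (c : ℝ) ≤ N := by exact_mod_cast hc
    calc (c : ℝ) ≤ N := hc'
      _ < (N : ℝ) + 2 := by linarith
      _ = ((N : ℝ) + 2) * 1 := (mul_one _).symm
      _ ≤ ((N : ℝ) + 2) * (rad a b c : ℝ) ^ (1 + ε) :=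
        mul_le_mul_of_nonneg_left hpow1 (by positivity)
  · rw [ht.one_add_lt_quality_iff, not_lt] at hq
    calc (c : ℝ) ≤ (rad a b c : ℝ) ^ (1 + ε) := hq
      _ = 1 * (rad a b c : ℝ) ^ (1 + ε) := (one_mul _).symm
      _ < ((N : ℝ) + 2) * (rad a b c : ℝ) ^ (1 + ε) :=
        mul_lt_mul_of_pos_right (by linarith [(N.cast_nonneg : (0 : ℝ) ≤ N)])
          (zero_lt_one.trans_le hpow1)

/-- **A cell of BoundedOmegaABC in its two forms**: abc with a constant `C(ε)` on `{ω(abc) ≤ W}` iff for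
every `δ > 0` only finitely many abc triples have `ω(abc) ≤ W` and quality `> 1 + δ`.
[cite: BombieriGubler2006, Rem. 12.4.15] -/
theorem boundedOmegaAt_iff_finite_violators (W : ℕ) :
    (∀ ε : ℝ, 0 < ε → ∃ C : ℝ, 0 < C ∧ ∀ a b c : ℕ, IsABCTriple a b c →
      (a * b * c).primeFactors.card ≤ W → (c : ℝ) < C * ((rad a b c : ℕ) : ℝ) ^ (1 + ε)) ↔
    ∀ δ : ℝ, 0 < δ → {t : ℕ × ℕ × ℕ | IsABCTriple t.1 t.2.1 t.2.2 ∧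
      (t.1 * t.2.1 * t.2.2).primeFactors.card ≤ W ∧ 1 + δ < quality t.1 t.2.1 t.2.2}.Finite :=
  ⟨finite_violators_of_boundedOmegaAt, boundedOmegaAt_of_finite_violators⟩

/-! ## The identification with `¬NegThesis` and the kill paths -/

/-- **BoundedOmegaABC IS `¬NegThesis`.** abc with a constant `C(W, ε)` on every bounded-`ω` cell — the
positive content of crux #2 modulo #6 — and the target `NegThesis` of the negative-side route
`NegOmegaAtlas` (stmt-ABC-1224: some `k`, `δ > 0` admit infinitely many abc triples with `ω(abc) ≤ k` and
quality `> 1 + δ`) are negations of each other (cell by cell, `boundedOmegaAt_iff_finite_violators`).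
[folklore] -/
theorem boundedOmega_iff_not_negThesis :
    (∀ W : ℕ, ∀ ε : ℝ, 0 < ε → ∃ C : ℝ, 0 < C ∧ ∀ a b c : ℕ, IsABCTriple a b c →
      (a * b * c).primeFactors.card ≤ W → (c : ℝ) < C * ((rad a b c : ℕ) : ℝ) ^ (1 + ε)) ↔
    ¬ NegThesis := by
  constructor
  · rintro hB ⟨W, δ, hδ, hinf⟩
    exact hinf (finite_violators_of_boundedOmegaAt (hB W) δ hδ)
  · intro hN W
    exact boundedOmegaAt_of_finite_violators fun δ hδ =>
      Set.not_infinite.mp fun hinf => hN ⟨W, δ, hδ, hinf⟩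

/-- **A proof of the crux refutes route `NegOmegaAtlas`'s target** (no #6 needed): the crux gives
BoundedOmegaABC (`HeavyPlaces.boundedOmega_of_uniformSadicTowerFour`), which is `¬NegThesis`. [folklore] -/
theorem not_negThesis_of_uniformSadicTowerFour (h : UniformSadicTowerFour) : ¬ NegThesis :=
  boundedOmega_iff_not_negThesis.mp (boundedOmega_of_uniformSadicTowerFour h)

/-- **Kill path (contrapositive)**: `NegThesis` refutes the crux — a first-class kill path of
stmt-ABC-14937 through an EXISTING item (stmt-ABC-1224 of route `NegOmegaAtlas`). [folklore] -/
theorem not_uniformSadicTowerFour_of_negThesis (h : NegThesis) : ¬ UniformSadicTowerFour :=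
  fun hU => not_negThesis_of_uniformSadicTowerFour hU h

/-- **Modulo #6 the crux is EXACTLY the negation of `NegThesis`**: under `DeepRegimeABC` (crux #6 of the
route, a hypothesis of its `closes`), `UniformSadicTowerFour ↔ ¬NegThesis`
(`HeavyPlaces.uniformSadicTowerFour_iff_boundedOmega_of_deepRegimeABC` followed by the identification).
[folklore] -/
theorem uniformSadicTowerFour_iff_not_negThesis (h₆ : DeepRegimeABC) :
    UniformSadicTowerFour ↔ ¬ NegThesis :=
  (uniformSadicTowerFour_iff_boundedOmega_of_deepRegimeABC h₆).trans boundedOmega_iff_not_negThesis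

/-- The first open rung of the atlas, `ThreeSlotFamily` (stmt-ABC-1227: infinitely many violators with
`ω(abc) ≤ 3`), implies `NegThesis` (take `k = 3`). [folklore] -/
theorem negThesis_of_threeSlotFamily (h : ThreeSlotFamily) : NegThesis := by
  obtain ⟨δ, hδ, hinf⟩ := h
  exact ⟨3, δ, hδ, hinf⟩

/-- Cell (II-U) `UnbalancedFamily` (stmt-ABC-1225) implies `NegThesis` (drop the balance clause
`min(a,b) ≤ c^(1-η)`). [folklore] -/
theorem negThesis_of_unbalancedFamily (h : UnbalancedFamily) : NegThesis := by
  obtain ⟨k, η, _hη, δ, hδ, hinf⟩ := h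
  refine ⟨k, δ, hδ, hinf.mono ?_⟩
  rintro ⟨a, b, c⟩ ⟨ht, hω, _hbal, hq⟩
  exact ⟨ht, hω, hq⟩

/-- Cell (II-B) `BalancedFamily` (stmt-ABC-1226) implies `NegThesis` (instantiate the balance clause at
`η = 1` and drop it). [folklore] -/
theorem negThesis_of_balancedFamily (h : BalancedFamily) : NegThesis := by
  obtain ⟨k, δ, hδ, hall⟩ := h
  refine ⟨k, δ, hδ, (hall 1 one_pos).mono ?_⟩
  rintro ⟨a, b, c⟩ ⟨ht, hω, _hbal, hq⟩
  exact ⟨ht, hω, hq⟩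

/-- **Kill path**: a proof of `NegOmegaAtlas`'s first open rung `ThreeSlotFamily` (stmt-ABC-1227)
refutes this crux. [folklore] -/
theorem not_uniformSadicTowerFour_of_threeSlotFamily (h : ThreeSlotFamily) : ¬ UniformSadicTowerFour :=
  not_uniformSadicTowerFour_of_negThesis (negThesis_of_threeSlotFamily h)

/-- **Kill path**: `UnbalancedFamily` (stmt-ABC-1225) refutes this crux. [folklore] -/
theorem not_uniformSadicTowerFour_of_unbalancedFamily (h : UnbalancedFamily) :
    ¬ UniformSadicTowerFour :=
  not_uniformSadicTowerFour_of_negThesis (negThesis_of_unbalancedFamily h)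

/-- **Kill path**: `BalancedFamily` (stmt-ABC-1226) refutes this crux. [folklore] -/
theorem not_uniformSadicTowerFour_of_balancedFamily (h : BalancedFamily) : ¬ UniformSadicTowerFour :=
  not_uniformSadicTowerFour_of_negThesis (negThesis_of_balancedFamily h)

/-! ## The `ω`-ladder: monotone in `W`; `W ≤ 2` is a theorem; the first open rung `W = 3` is `¬ThreeSlotFamily` -/

/-- **The ladder is monotone**: abc with a constant on the cell `{ω(abc) ≤ W'}` gives it, with the same
constant, on every smaller cell `{ω(abc) ≤ W}`, `W ≤ W'`. [folklore] -/
theorem boundedOmegaAt_mono {W W' : ℕ} (hWW' : W ≤ W')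
    (h : ∀ ε : ℝ, 0 < ε → ∃ C : ℝ, 0 < C ∧ ∀ a b c : ℕ, IsABCTriple a b c →
      (a * b * c).primeFactors.card ≤ W' → (c : ℝ) < C * ((rad a b c : ℕ) : ℝ) ^ (1 + ε)) :
    ∀ ε : ℝ, 0 < ε → ∃ C : ℝ, 0 < C ∧ ∀ a b c : ℕ, IsABCTriple a b c →
      (a * b * c).primeFactors.card ≤ W → (c : ℝ) < C * ((rad a b c : ℕ) : ℝ) ^ (1 + ε) := by
  intro ε hε
  obtain ⟨C, hC, hCabc⟩ := h ε hε
  exact ⟨C, hC, fun a b c ht hω => hCabc a b c ht (hω.trans hWW')⟩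

/-- **Rungs `0, 1, 2` are closed**: abc with a constant (in fact `C = 2`) on every cell `{ω(abc) ≤ W}`,
`W ≤ 2` — monotonicity down from the landed rung `W = 2` (`MixedRadical.stub_omegaCounted_two`, p97349:
the cell is `{1+1=2, (1, q, 2^j), (1, 2^i, q), (1, 8, 9)}`, `c < 2·rad`). [folklore] -/
theorem boundedOmegaAt_of_le_two {W : ℕ} (hW : W ≤ 2) :
    ∀ ε : ℝ, 0 < ε → ∃ C : ℝ, 0 < C ∧ ∀ a b c : ℕ, IsABCTriple a b c →
      (a * b * c).primeFactors.card ≤ W → (c : ℝ) < C * ((rad a b c : ℕ) : ℝ) ^ (1 + ε) :=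
  boundedOmegaAt_mono hW stub_omegaCounted_two

/-- **The first open rung is `NegOmegaAtlas`'s `ThreeSlotFamily`, negated**: abc with a constant `C(ε)`
on the cell `{ω(abc) ≤ 3}` (uniform abc for the `{1, p^x q^y, r^z}`-type and the three-prime-power
`p^x + q^y = r^z` triples) iff `¬ThreeSlotFamily` (stmt-ABC-1227). [folklore] -/
theorem boundedOmegaAt_three_iff_not_threeSlotFamily :
    (∀ ε : ℝ, 0 < ε → ∃ C : ℝ, 0 < C ∧ ∀ a b c : ℕ, IsABCTriple a b c →
      (a * b * c).primeFactors.card ≤ 3 → (c : ℝ) < C * ((rad a b c : ℕ) : ℝ) ^ (1 + ε)) ↔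
    ¬ ThreeSlotFamily := by
  refine (boundedOmegaAt_iff_finite_violators 3).trans ⟨?_, ?_⟩
  · rintro h ⟨δ, hδ, hinf⟩
    exact hinf (h δ hδ)
  · intro h δ hδ
    exact Set.not_infinite.mp fun hinf => h ⟨δ, hδ, hinf⟩

/-- Hence the crux needs rung 3: `UniformSadicTowerFour → ¬ThreeSlotFamily` (the crux gives every cell,
`HeavyPlaces.boundedOmega_of_uniformSadicTowerFour`, and rung 3 is `¬ThreeSlotFamily`); modulo #6,
refuting `ThreeSlotFamily` is exactly proving rung 3 of the crux's normal form. [folklore] -/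
theorem not_threeSlotFamily_of_uniformSadicTowerFour (h : UniformSadicTowerFour) : ¬ ThreeSlotFamily :=
  boundedOmegaAt_three_iff_not_threeSlotFamily.mp (boundedOmega_of_uniformSadicTowerFour h 3)

end Summit.ABC.ABC.Theorems.UniformSadicTowerFour.BoundedOmega

end
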